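import Summits.Ventures.HSemireg.UntwistComplexSigmaTwist
import Summits.Ventures.HSemireg.PerfectComplexSigmaLinks
import Summits.Ventures.HSemireg.AmplificationChainSigmaGluable
import Mathlib.CategoryTheory.Linear.LinearFunctor
import HarnessLib

/-!
# Venture HSemireg — route R1.0 at the DOOR level: the σ-admissibility predicates of the perfect-complex door are closed
# under cocycle twists `K ↦ K ⊗ M_c` (gs-g4; wiring of `HomComplex.isISemiregularC_iff_twist` into `sigmaAdmissible` /
# `gluableSigmaAdmissible`)

HONEST FRAMING. Venture-lane plumbing on the tree's real carriers; a REDUCTION, not a door: it certifies no object, moves no census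
cell, and nothing here says HC, HC_CM or HC_AV is proved. For the μ₂-twisted objects of the «D4 (residual)» row in the untwisted
reading of record (lead R-49(a)/R-51(a): `E₀′ = E₀ ⊗ M_B` on the fibres where the `B`-class is integral) it says, at the level of the
door predicates consumed by the cell's end forms (`PerfectComplexSigmaDoor.sigmaAdmissible`, `AmplificationChainSigmaGluable.
gluableSigmaAdmissible`): **`E₀ ⊗ M` passes the σ-door iff `E₀` does** (for index sets `I` with `{q | q + 1 ∈ I}` a lower set, e.g.
`I = {1..n}` or `I = {0..n}`), for EVERY unit `1`-cocycle `c` (`M = lineBundle c`).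

CONTENTS (all proved; Mathlib + tree only):
1. `CocycleTwist.twistMap_globalScalar`, `twistMap_smul` — th-4's twist functor `F ↦ F⟨c⟩` commutes with multiplication by global
   functions; hence it is `Γ(X, 𝒪_X)`-linear (`twistFunctor_linear_globalSections`) and, on a `k`-scheme, `k`-linear
   (`twistFunctor_linear_base`, for the tree's `instLinearOverBase`) — instances.
2. `CocycleTwist.extRank_cocycleTwistComplex` — `rank_ℂ Hom_{D(X₀)}(E ⊗ M, (E ⊗ M)⟦n⟧) = rank_ℂ Hom_{D(X₀)}(E, E⟦n⟧)` for every cochain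
   complex `E` on a `ℂ`-scheme `X₀` and every `n` (p4's `extRank`; `DerivedEquivalenceExtRank.extRank_eq_of_iso_obj` at
   `Ψ = D(- ⊗ M)`, full and faithful by th-4's `full/faithful_mapDerivedCategory_of_equivalence`, `ℂ`-linear by (1) + Mathlib).
3. `isBoundedVBComplex_cocycleTwistComplex` — `E ⊗ M` is a bounded complex of vector bundles if `E` is.
4. **`CocycleTwist.sigmaAdmissible_cocycleTwistComplex_iff`** / **`gluableSigmaAdmissible_cocycleTwistComplex_iff`** —
   `sigmaAdmissible n X₀ I (E ⊗ M_c) ↔ sigmaAdmissible n X₀ I E` (and the gluable variant) whenever `{q | q + 1 ∈ I}` is a lower set;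
   helpers `isLowerSet_succ_mem_Icc` (`I = {1..m}`), `isLowerSet_succ_mem_range` (`I = {0..m-1}`).

## References

* R.-O. Buchweitz, H. Flenner, *A semiregularity map for modules and applications to deformations*, Compositio Math. 137 (2003),
  Def. 4.1, §5 (`I`-semiregular). [BuchweitzFlenner2003]
* U. Görtz, T. Wedhorn, *Algebraic Geometry I*, 2nd ed. (2020), §(7.3), (7.3.6) (the `Γ(X, 𝒪_X)`-module structure on `Hom`).
  [GortzWedhorn2020]
-/

noncomputable section

set_option backward.isDefEq.respectTransparency false

open CategoryTheory CategoryTheory.Limits AlgebraicGeometry TopologicalSpace Opposite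

namespace Summit.Ventures.HSemireg

namespace CocycleTwist

open Literature.AlgebraicGeometry.Modules Literature.AlgebraicGeometry.Motives Literature.AlgebraicGeometry.HodgeTheory
  Literature.AlgebraicGeometry.KTheory HomComplex

/-! ### 1. The twist functor is linear over `Γ(X, 𝒪_X)` and over the base ring -/

section Linear

universe u

variable {X : Scheme.{u}} (c : UnitCocycle X)

/-- **`(a · 𝟙_F)⟨c⟩ = a · 𝟙_{F⟨c⟩}`**: twisting commutes with multiplication by a global function `a ∈ Γ(X, 𝒪_X)` (componentwise
both are multiplication by `a|_{V ∩ U_x}`). [cite: GortzWedhorn2020, §(7.3), (7.3.6)] -/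
theorem twistMap_globalScalar (F : X.Modules) (a : Γ(X, ⊤)) :
    twistMap c (globalScalar F a) = globalScalar (twist c F) a := by
  ext V s x
  rw [comp_twistMap_app, globalScalar_app_apply, globalScalar_app_apply, comp_smul]
  congr 1
  change _ = (X.presheaf.map _ ≫ X.presheaf.map _) a
  rw [← X.presheaf.map_comp]
  rfl

/-- **`(a · φ)⟨c⟩ = a · φ⟨c⟩`** for a global function `a`. [cite: GortzWedhorn2020, §(7.3), (7.3.6)] -/
theorem twistMap_smul {F G : X.Modules} (a : Γ(X, ⊤)) (φ : F ⟶ G) : twistMap c (a • φ) = a • twistMap c φ := by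
  rw [smul_eq_globalScalar_comp, smul_eq_globalScalar_comp, twistMap_comp, twistMap_globalScalar]

/-- **The twist functor is `Γ(X, 𝒪_X)`-linear.** [cite: GortzWedhorn2020, §(7.3), (7.3.6)] -/
instance twistFunctor_linear_globalSections : (twistFunctor X c).Linear Γ(X, ⊤) where
  map_smul φ a := twistMap_smul c a φ

variable {k : Type u} [CommRing k] (Y : Over (Spec (CommRingCat.of k))) (c' : UnitCocycle Y.left)

/-- **The twist functor on a `k`-scheme is `k`-linear** (the tree's `instLinearOverBase`: `r • φ = r|_X · φ`). [folklore] -/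
instance twistFunctor_linear_base : (twistFunctor Y.left c').Linear k where
  map_smul φ r := by
    change twistMap c' (r • φ) = r • twistMap c' φ
    rw [base_smul_def, base_smul_def, twistMap_smul]

/-- The functor of the twist equivalence is `k`-linear (same functor). [folklore] -/
instance twistEquivalence_functor_linear_base : (twistEquivalence Y.left c').functor.Linear k :=
  twistFunctor_linear_base Y c'

/-- The inverse of the twist equivalence is `k`-linear (the twist by `c⁻¹`). [folklore] -/
instance twistEquivalence_inverse_linear_base : (twistEquivalence Y.left c').inverse.Linear k :=
  twistFunctor_linear_base Y c'.inv

end Linear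

/-! ### 2. `Ext` ranks in `D(X₀)` are twist-invariant -/

section ExtRank

variable (X₀ : SchemeOver ℂ) (c : UnitCocycle X₀.left) (E : CochainComplex X₀.left.Modules ℤ)

/-- **`rank_ℂ Hom_{D(X₀)}(E ⊗ M, (E ⊗ M)⟦n⟧) = rank_ℂ Hom_{D(X₀)}(E, E⟦n⟧)`** for every cochain complex `E` and every `n`: `D(- ⊗ M)` is
full, faithful, `ℂ`-linear and commutes with shifts, and `D(- ⊗ M)(Q E) ≅ Q(E ⊗ M)`. [cite: BuchweitzFlenner2003, §1 (Ext²_X(F,F))] -/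
theorem extRank_cocycleTwistComplex (n : ℤ) : extRank X₀ (cocycleTwistComplex c E) n = extRank X₀ E n := by
  letI := HasDerivedCategory.standard X₀.left.Modules
  haveI := full_mapDerivedCategory_of_equivalence (twistEquivalence X₀.left c)
  haveI := faithful_mapDerivedCategory_of_equivalence (twistEquivalence X₀.left c)
  exact extRank_eq_of_iso_obj E (cocycleTwistComplex c E) (twistEquivalence X₀.left c).functor.mapDerivedCategory
    ((twistEquivalence X₀.left c).functor.mapDerivedCategoryFactors.app E) n

end ExtRank

/-! ### 3. Bounded complexes of vector bundles -/

section Bounded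

universe u

variable {S : Type u} [CommRing S] {X₀ : Over (Spec (CommRingCat.of S))} (c : UnitCocycle X₀.left)
  {E : CochainComplex X₀.left.Modules ℤ}

/-- **`E ⊗ M` is a bounded complex of vector bundles if `E` is** (terms: `isFiniteLocallyFree_twist`; zero terms stay zero under the
additive functor `- ⊗ M`). [folklore] -/
theorem isBoundedVBComplex_cocycleTwistComplex (hE : IsBoundedVBComplex E) :
    IsBoundedVBComplex (cocycleTwistComplex c E) := by
  obtain ⟨s, hs⟩ := hE.exists_finset
  exact ⟨isFiniteLocallyFree_cocycleTwistComplex_X c hE.isFiniteLocallyFree,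
    ⟨s, fun i hi => (twistFunctor X₀.left c).map_isZero (hs i hi)⟩⟩

end Bounded

/-! ### 4. The σ-door predicates are closed under cocycle twists -/

section Door

/-- `{q | q + 1 ∈ {1..m}}` is a lower set. [folklore] -/
theorem isLowerSet_succ_mem_Icc (m : ℕ) : IsLowerSet {q : ℕ | q + 1 ∈ Finset.Icc 1 m} := by
  intro a b hba ha
  simp only [Set.mem_setOf_eq, Finset.mem_Icc] at ha ⊢
  omega

/-- `{q | q + 1 ∈ {0..m-1}}` is a lower set. [folklore] -/
theorem isLowerSet_succ_mem_range (m : ℕ) : IsLowerSet {q : ℕ | q + 1 ∈ Finset.range m} := by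
  intro a b hba ha
  simp only [Set.mem_setOf_eq, Finset.mem_range] at ha ⊢
  omega

variable {n : ℕ} {X₀ : SchemeOver ℂ} {I : Finset ℕ} (c : UnitCocycle X₀.left) (E : CochainComplex X₀.left.Modules ℤ)

/-- **If `E` is σ-admissible then so is `E ⊗ M_c`** (`{q | q + 1 ∈ I}` a lower set): same bounds, twisted terms finite locally free,
`Ext`-rank clauses by `extRank_cocycleTwistComplex`, the semiregularity clause by `HomComplex.isISemiregularC_iff_twist`.
[cite: BuchweitzFlenner2003, Def. 4.1 and §5 (I-semiregular)] -/
theorem sigmaAdmissible_cocycleTwistComplex (hI : IsLowerSet {q : ℕ | q + 1 ∈ I}) (h : sigmaAdmissible n X₀ I E) :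
    sigmaAdmissible n X₀ I (cocycleTwistComplex c E) := by
  letI := HasDerivedCategory.standard X₀.left.Modules
  obtain ⟨hIn, hneg, h0, a, b, _, _, hE, hσ⟩ := h
  refine ⟨hIn, fun k hk => ?_, ?_, a, b, inferInstance, inferInstance, isFiniteLocallyFree_cocycleTwistComplex_X c hE, ?_⟩
  · rw [extRank_cocycleTwistComplex]; exact hneg k hk
  · rw [extRank_cocycleTwistComplex]; exact h0
  · exact (isISemiregularC_iff_twist X₀ E c a b hE hI).1 hσ

/-- **If `E` is gluable-σ-admissible then so is `E ⊗ M_c`** (`{q | q + 1 ∈ I}` a lower set). [cite: BuchweitzFlenner2003, §5 (I-semiregular)] -/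
theorem gluableSigmaAdmissible_cocycleTwistComplex (hI : IsLowerSet {q : ℕ | q + 1 ∈ I}) (h : gluableSigmaAdmissible n X₀ I E) :
    gluableSigmaAdmissible n X₀ I (cocycleTwistComplex c E) := by
  letI := HasDerivedCategory.standard X₀.left.Modules
  obtain ⟨hIn, hneg, a, b, _, _, hE, hσ⟩ := h
  refine ⟨hIn, fun k hk => ?_, a, b, inferInstance, inferInstance, isFiniteLocallyFree_cocycleTwistComplex_X c hE, ?_⟩
  · rw [extRank_cocycleTwistComplex]; exact hneg k hk
  · exact (isISemiregularC_iff_twist X₀ E c a b hE hI).1 hσ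

/-- Untwisting: `E ≅ (E ⊗ M_c) ⊗ M_{c⁻¹}` as cochain complexes (the unit of th-4's `twistEquivalence`, termwise). [folklore] -/
def cocycleTwistComplexUnitIso : E ≅ cocycleTwistComplex c.inv (cocycleTwistComplex c E) :=
  ((twistEquivalence X₀.left c).mapHomologicalComplex (ComplexShape.up ℤ)).unitIso.app E

/-- **`E ⊗ M_c` is σ-admissible iff `E` is** (`{q | q + 1 ∈ I}` a lower set; every cocycle `c`): the converse by twisting back
with `c⁻¹` and `sigmaAdmissible_iff_of_iso` along `E ≅ (E ⊗ M_c) ⊗ M_{c⁻¹}`. [cite: BuchweitzFlenner2003, Def. 4.1 and §5 (I-semiregular)] -/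
theorem sigmaAdmissible_cocycleTwistComplex_iff (hI : IsLowerSet {q : ℕ | q + 1 ∈ I}) :
    sigmaAdmissible n X₀ I (cocycleTwistComplex c E) ↔ sigmaAdmissible n X₀ I E :=
  ⟨fun h => sigmaAdmissible_of_iso (cocycleTwistComplexUnitIso c E).symm
      (sigmaAdmissible_cocycleTwistComplex c.inv _ hI h),
    sigmaAdmissible_cocycleTwistComplex c E hI⟩

/-- `gluableSigmaAdmissible` is invariant under isomorphisms of complexes. [cite: BuchweitzFlenner2003, §5 (I-semiregular)] -/
theorem gluableSigmaAdmissible_of_iso {E E' : CochainComplex X₀.left.Modules ℤ} (e : E ≅ E')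
    (h : gluableSigmaAdmissible n X₀ I E) : gluableSigmaAdmissible n X₀ I E' := by
  letI := HasDerivedCategory.standard X₀.left.Modules
  obtain ⟨hIn, hneg, a, b, _, _, hE, hσ⟩ := h
  have hE' : ∀ i, IsFiniteLocallyFree (E'.X i) := fun i =>
    isFiniteLocallyFree_of_iso ((HomologicalComplex.eval _ _ i).mapIso e) (hE i)
  haveI := CochainComplex.isStrictlyGE_of_iso e a
  haveI := CochainComplex.isStrictlyLE_of_iso e b
  refine ⟨hIn, fun k hk => ?_, a, b, inferInstance, inferInstance, hE', ?_⟩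
  · rw [← extRank_eq_of_quasiIso X₀ e.hom k]; exact hneg k hk
  · exact (isISemiregularC_iff_of_iso X₀ a b hE hE' e _).1 hσ

/-- **`E ⊗ M_c` is gluable-σ-admissible iff `E` is** (`{q | q + 1 ∈ I}` a lower set; every cocycle `c`).
[cite: BuchweitzFlenner2003, §5 (I-semiregular)] -/
theorem gluableSigmaAdmissible_cocycleTwistComplex_iff (hI : IsLowerSet {q : ℕ | q + 1 ∈ I}) :
    gluableSigmaAdmissible n X₀ I (cocycleTwistComplex c E) ↔ gluableSigmaAdmissible n X₀ I E :=
  ⟨fun h => gluableSigmaAdmissible_of_iso (cocycleTwistComplexUnitIso c E).symm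
      (gluableSigmaAdmissible_cocycleTwistComplex c.inv _ hI h),
    gluableSigmaAdmissible_cocycleTwistComplex c E hI⟩

end Door

end CocycleTwist

end Summit.Ventures.HSemireg

end
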